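/-
Copyright: lit-balaban Phase-2 proof seat p08 (gen 8).  Statement-level skeleton of a published paper; no proof claims beyond what
the kernel checks below.
-/
import Literature.MathematicalPhysics.QuantumFieldTheory.BalabanImbrieJaffe1984to88.BIJ85CurlyDkHolderTerm

/-!
# `BalabanImbrieJaffe1984to88.BIJ85CurlyDkHolderSum` — T. Bałaban, J. Imbrie, A. Jaffe, *Renormalization of the Higgs model: minimizers,
propagators and the stability of mean field theory*, Commun. Math. Phys. **97** (1985) 299–329 [BalabanImbrieJaffe1985]: Sect. 7.2,
p. 326, **the HÖLDER member of «𝒟_k has the same properties as G_k in [6I], Proposition 1.2» ON THE TORI FOR THE `𝒟_k` OF RECORD**,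
file 2 of 3 (the multiscale sum): *"the rapid decay of the terms with small j compensates for the scaling factors"* once more — the
scale-`j` term of file 1 carries `L^{−j}(L^{k−j}r)^α(L^{k−j})^{d−2} ≤ L^{−k}r^α(L^{k−j})^d` against `e^{−aL^{k−j}(D−1)}`, summable in `j`

statement-level skeleton of published theorems with citation tags; proofs where landed; nothing here is a claim about the Yang–Mills mass gap

PDF held: `paper:balaban1985-cmp97-bij-higgs-minimizers` (journal page = PDF page + 298), p. 312 [PDF 14], pp. 325–326 [PDF 27–28]
(text layer `~/.lit/texts/paper-balaban1985-cmp97-bij-higgs-minimizers/p0014.txt`, `p0027.txt`, `p0028.txt`, re-read this session);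
[6I] = [Balaban1984PropagatorsI] Prop. 1.2 (tree name `Balaban1983to89.B5.Prop12Printed`).

CITATION HEADER (lean-in-tree rule).  Part of the lit-balaban TYPED SKELETON (HOME `run/shared/lean/pub/lit-balaban/`), Phase-2 proof
seat p08 (gen 8), unit `lit-balaban-p08`; WHAT IS REPRODUCED = the located sentence of SKELETON row **C1.Eq7.2.4** (owner r15, referee
ref-5), HÖLDER MEMBER, for the `𝒟_k` of record of rows **C1.Eq4.4.4** / **C2.Eq2.12**, kind «model instance».  TAKING line HOME/STATUS.md
2026-08-21T19:42:18Z.  Decls used BY NAME (nothing restated): file 1's `BIJ85CurlyDkHolderTerm.dkKernel_secondDiff_eq_sum`/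
`abs_holderTermDk_le`; the tree's `supDist_triangle`.

THE PRINTED TEXT (p. 326 [PDF 28], verbatim): *"The operators 𝒟_k have the same properties as the operators G_k in [6I], Proposition 1.2,
with exponential decay but singularities on the diagonal. These properties follow from (4.4.4) and the above estimates on H_k, C^{(k)}."*;
(7.2.2) p. 325: *"there exists δ > 0 and for 0 ≦ α < 1 a constant M = M(α) < ∞ such that for |x − x′| ≦ 1, |H_{k,μν}(x,y)| +
|∇H_{k,μν}(x,y)| + |x − x′|^{−α}|∇H_{k,μν}(x,y) − ∇H_{k,μν}(x′,y)| ≦ Me^{−δ|x−y|}. (7.2.2)"*; (7.2.3) p. 325 *"|C^{(k)}_{μν}(x,y)| ≦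
Me^{−δ|x−y|}"*; (4.4.4) p. 312 *"𝒟_k = Σ_{j=0}^{k−1} H_jC^{(j)}H_j*"*.

THE TORUS DATA (all in the tree; as in the companion files): tori `Balaban1983to89.Setup`/`Params` (`d ≥ 2`, standing range
`k ≤ m + K`, `η_k = L^{−k}`); fine sites `x, x′ : Site P 0`, `η`-bonds `⟨x, μ⟩ : PBond P 0`; `ℓ^∞` distances `|·|_∞/L^k` in the unit of
`T₁^{(k)}` (`supDist`); the kernel `𝒟_k(b, b″) := (𝒟_ke_{b″})(b)` of p11's `DkE P η_k^d L^k k` and its `η`-difference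
`Δ_λ𝒟_k(⟨x, μ⟩, b″) := 𝒟_k(⟨x+e_λ, μ⟩, b″) − 𝒟_k(⟨x, μ⟩, b″)`; the scale-`j` Landau kernels `H_{j,μν}(x; y)` of p09's
`torusRep P j (deltaAData …)` and the three members of (7.2.2) in the shape of p09's carrier `torusKernelData` (`gradH`, `gradHDiff` =
sup over `λ` of `L^j`·forward differences; `distEta = |x − x′|_∞/L^j`); the unit-lattice matrices of p11's `CE P η_j^d L^j j`.

WHAT IS PROVED (0 `sorry`, standard axioms; theorems only — proof lane; every `d ≥ 2`):
* **`abs_holderTermDk_scaled_le`**: for `x ≠ x′`, `r = |x − x′|_∞/L^k ≤ 1`, `D = |x − b″₋|_∞/L^k ≥ 3`, `0 ≤ α ≤ 1`: the scale-`j` term is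
  at most `L^{−k}r^α·2(M + M_α)MM_C·d²e^{a/2}K(a)²·((d+1)!/(a^{d+1}L^{k−j}))·e^{a/2}e^{−(a/2)D}`, `a = min(δ, δ_C)/2`.
* **`abs_dkKernel_secondDiff_le`**: `|Δ_λ𝒟_k(⟨x, μ⟩, b″) − Δ_λ𝒟_k(⟨x′, μ⟩, b″)| ≤ L^{−k}r^α·2(M + M_α)MM_C·d²e^{a/2}K(a)²·(d+1)!/a^{d+1}·
  e^{a/2}·e^{−(a/2)D}` (`Σ_{j<k}L^{−(k−j)} ≤ 1`) — the Hölder quotient `|x − x′|^{−α}|∇𝒟_k(x, b″) − ∇𝒟_k(x′, b″)|` (`∇ = η⁻¹Δ`) decays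
  exponentially with constants UNIFORM IN `k`, given the three members of (7.2.2) for every `H_j`, `j < k`, and the unit-lattice (7.2.3).
HONEST SCOPE.  (i) Explicit-constant statements under displayed per-scale hypotheses; the assembly from `B5.Prop12Printed` is file 3.
(ii) Thresholds `|x − x′|_∞/L^k ≤ 1`, `|x − b″₋|_∞/L^k ≥ 3`; constants explicit, not optimal.  (iii) `U = 1`, real abelian fields, torus,
standing range.  (iv) No `def`, no new named fact, nothing restated; NOT summit progress.  Unit `lit-balaban-p08`
(literature-prover-lit-balaban-p08-g8-0), 2026-08-21.
-/

open scoped BigOperators RealInnerProductSpace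

namespace Literature.MathematicalPhysics.QuantumFieldTheory.BalabanImbrieJaffe1984to88.BIJ85CurlyDkHolderSum

open Balaban1983to89 hiding Site Plaq
open Balaban1983to89.LatticeFieldCalculus
open Balaban1983to89.B3TorusRadialSums (supDist_eq_zero_iff)
open BIJ88SigmaKernelDkTorus BIJ88Ineq217Ineq722Torus BIJ88Decay216Torus
open BIJ85AxialPropagator411 BIJ85Prop521Torus BIJ85Prop522Torus BIJ85Sigma422Eta
open BIJ85Sect7Statements BIJ85Ineq722Torus BIJ85Eq721MinimizerKernel
open BIJ85Ineq722DeltaA (deltaAData ineq722_deltaA_of_prop12Printed)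
open BIJ85Ineq722ProofPart2 (settingOf)
open BIJ88Decay216Native (abs_inner_cE_ambient_le)
open BIJ88Decay216Prop12 (ineq723_CE_torus)
open BIJ85CurlyDkHolderTerm (dkKernel_secondDiff_eq_sum abs_holderTermDk_le)
-- inside this namespace the bare `Site`/`Plaq` are the `ℤ^d` carriers of the QFT root; the torus ones are renamed:
open Balaban1983to89 renaming Site → TSite, Plaq → TPlaq

noncomputable section

variable {P : Params}

/-! ## §3  The multiscale sum for the Hölder quotient -/

/-- `0 < L^n`. [folklore] -/
private theorem cast_pow_L_pos' (n : ℕ) : (0 : ℝ) < (P.L : ℝ) ^ n := pow_pos P.cast_L_pos n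


/-- `x^q·e^{−ax} ≤ (q+1)!/(a^{q+1}x)` (`a, x > 0`; r18 g8 / p08 g8 private lemma, re-proved). [folklore] -/
private theorem pow_mul_exp_neg_le {a x : ℝ} (ha : 0 < a) (hx : 0 < x) (q : ℕ) :
    x ^ q * Real.exp (-(a * x)) ≤ ((q + 1).factorial : ℝ) / (a ^ (q + 1) * x) := by
  have h := Real.pow_div_factorial_le_exp (a * x) (by positivity) (q + 1)
  rw [div_le_iff₀ (by positivity)] at h
  rw [le_div_iff₀ (by positivity)]
  calc x ^ q * Real.exp (-(a * x)) * (a ^ (q + 1) * x) = (a * x) ^ (q + 1) * Real.exp (-(a * x)) := by ring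
    _ ≤ Real.exp (a * x) * ((q + 1).factorial : ℝ) * Real.exp (-(a * x)) := mul_le_mul_of_nonneg_right h (Real.exp_pos _).le
    _ = ((q + 1).factorial : ℝ) := by
        rw [mul_comm (Real.exp _), mul_assoc, ← Real.exp_add, add_neg_cancel, Real.exp_zero, mul_one]

/-- `Σ_{j<k} L^{−(k−j)} ≤ 1` (`L ≥ 2`; induction: `S_{k+1} = L⁻¹(S_k + 1)`). [folklore] -/
private theorem sum_inv_pow_le_one (k : ℕ) : ∑ j ∈ Finset.range k, ((P.L : ℝ) ^ (k - j))⁻¹ ≤ 1 := by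
  have hL : (2 : ℝ) ≤ P.L := by exact_mod_cast P.hL.2
  induction k with
  | zero => simp
  | succ k ih =>
    have e : ∑ j ∈ Finset.range (k + 1), ((P.L : ℝ) ^ (k + 1 - j))⁻¹ =
        (P.L : ℝ)⁻¹ * (∑ j ∈ Finset.range k, ((P.L : ℝ) ^ (k - j))⁻¹ + 1) := by
      rw [Finset.sum_range_succ, show k + 1 - k = 1 by omega, pow_one, mul_add, mul_one, Finset.mul_sum]
      refine congrArg (· + _) (Finset.sum_congr rfl fun j hj => ?_)
      rw [show k + 1 - j = (k - j) + 1 by have := Finset.mem_range.1 hj; omega, pow_succ, mul_inv, mul_comm]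
    rw [e]
    calc (P.L : ℝ)⁻¹ * (∑ j ∈ Finset.range k, ((P.L : ℝ) ^ (k - j))⁻¹ + 1) ≤ 2⁻¹ * (1 + 1) :=
          mul_le_mul ((inv_le_inv₀ (by linarith) two_pos).2 hL) (by linarith) (by positivity) (by norm_num)
      _ = 1 := by norm_num

/-- `L^k = L^j·L^{k−j}` for `j ≤ k`. [folklore] -/
private theorem pow_eq_pow_mul_pow' {j k : ℕ} (hjk : j ≤ k) : (P.L : ℝ) ^ k = (P.L : ℝ) ^ j * (P.L : ℝ) ^ (k - j) := by
  rw [← pow_add, Nat.add_sub_cancel' hjk]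

/-- **THE SCALE-`j` TERM AGAINST THE SCALING FACTORS** (`j < k ≤ m + K`): for `x ≠ x′` with `r := |x − x′|_∞/L^k ≤ 1` and
`D := |x − b″₋|_∞/L^k ≥ 3`, the scale-`j` term of the second difference is at most
`L^{−k}·r^α·2(M + M_α)MM_C·d²e^{a/2}K(a)²·((d+1)!/(a^{d+1}L^{k−j}))·e^{a/2}e^{−(a/2)D}`, `a = min(δ, δ_C)/2`: in §2's bound,
`L^{−j}(L^{k−j}r)^α(L^{k−j})^{d−2} ≤ L^{−k}r^α(L^{k−j})^d` (`ℓ^α ≤ ℓ` for `α ≤ 1 ≤ ℓ`), both exponentials are `≤ e^{−aL^{k−j}(D−1)}`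
(`|x′ − b″₋|_∞/L^k ≥ D − 1` by the triangle inequality), and `ℓ^de^{−aℓ(D−1)} ≤ ℓ^de^{−aℓ}·e^{a/2}e^{−(a/2)D} ≤ (d+1)!/(a^{d+1}ℓ)·e^{a/2}e^{−(a/2)D}`.
[cite: BalabanImbrieJaffe1985, (4.4.4) p.312] -/
theorem abs_holderTermDk_scaled_le (hd : 2 ≤ P.d) {k j : ℕ} (hjk : j < k) (hj : j ≤ P.m + P.K) {a : ℝ}
    (ha : 0 < a) {δ M Mα α δC MC : ℝ} (hδ : 0 < δ) (hδC : 0 < δC) (hM : 0 ≤ M) (hMα : 0 ≤ Mα) (hα : 0 ≤ α) (hα1 : α ≤ 1)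
    (hMC : 0 ≤ MC)
    (hH : ∀ (μ ν : Fin P.d) (x : TSite P 0) (y : TSite P j),
      |(torusRep P j (deltaAData hj a)).H (x, μ) (y, ν)| ≤ M * Real.exp (-(δ * distEU P j x y)))
    (hB : ∀ (μ ν : Fin P.d) (x : TSite P 0) (y : TSite P j),
      ‖fun lam : Fin P.d => (P.L : ℝ) ^ j *
          ((torusRep P j (deltaAData hj a)).H (x.shift lam, μ) (y, ν) - (torusRep P j (deltaAData hj a)).H (x, μ) (y, ν))‖ ≤
        M * Real.exp (-(δ * distEU P j x y)))
    (hHol : ∀ (μ ν : Fin P.d) (x x' : TSite P 0) (y : TSite P j), x ≠ x' → (supDist x x' : ℝ) / (P.L : ℝ) ^ j ≤ 1 →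
      ((supDist x x' : ℝ) / (P.L : ℝ) ^ j) ^ (-α) *
          ‖fun lam : Fin P.d => (P.L : ℝ) ^ j * ((torusRep P j (deltaAData hj a)).H (x.shift lam, μ) (y, ν) -
              (torusRep P j (deltaAData hj a)).H (x, μ) (y, ν)) -
            (P.L : ℝ) ^ j * ((torusRep P j (deltaAData hj a)).H (x'.shift lam, μ) (y, ν) -
              (torusRep P j (deltaAData hj a)).H (x', μ) (y, ν))‖ ≤
        Mα * Real.exp (-(δ * distEU P j x y)))
    (hC : ∀ b₁ b₂ : PBond P j, |⟪toEj P j (Pi.single b₁ 1),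
      CE P ((P.eta j) ^ P.d) ((P.L : ℝ) ^ j) j (toEj P j (Pi.single b₂ 1))⟫| ≤ MC * Real.exp (-(δC * (supDist b₁.src b₂.src : ℝ))))
    {x x' : TSite P 0} (hne : x ≠ x') (hr : (supDist x x' : ℝ) / (P.L : ℝ) ^ k ≤ 1) (μ lam : Fin P.d) {b'' : PBond P 0}
    (hD : 3 ≤ (supDist x b''.src : ℝ) / (P.L : ℝ) ^ k) :
    |∑ b₁ : PBond P j, ∑ b₂ : PBond P j,
        ((HkE P ((P.eta k) ^ P.d) ((P.L : ℝ) ^ k) j (toEj P j (Pi.single b₁ 1)) ⟨x.shift lam, μ⟩ -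
              HkE P ((P.eta k) ^ P.d) ((P.L : ℝ) ^ k) j (toEj P j (Pi.single b₁ 1)) ⟨x, μ⟩) -
            (HkE P ((P.eta k) ^ P.d) ((P.L : ℝ) ^ k) j (toEj P j (Pi.single b₁ 1)) ⟨x'.shift lam, μ⟩ -
              HkE P ((P.eta k) ^ P.d) ((P.L : ℝ) ^ k) j (toEj P j (Pi.single b₁ 1)) ⟨x', μ⟩)) *
          ⟪toEj P j (Pi.single b₁ 1), CE P ((P.eta k) ^ P.d) ((P.L : ℝ) ^ k) j (toEj P j (Pi.single b₂ 1))⟫ *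
          HkE P ((P.eta k) ^ P.d) ((P.L : ℝ) ^ k) j (toEj P j (Pi.single b₂ 1)) b''| ≤
      ((P.L : ℝ) ^ k)⁻¹ * ((supDist x x' : ℝ) / (P.L : ℝ) ^ k) ^ α *
        (2 * ((M + Mα) * M * MC) * ((P.d : ℝ) ^ 2 * (Real.exp (min δ δC / 2 / 2) * ((2 * (1 + P.d / (min δ δC / 2))) ^ P.d) ^ 2))) *
        ((((P.d + 1).factorial : ℝ) / ((min δ δC / 2) ^ (P.d + 1) * (P.L : ℝ) ^ (k - j))) *
          (Real.exp (min δ δC / 2 / 2) * Real.exp (-(min δ δC / 2 / 2 * ((supDist x b''.src : ℝ) / (P.L : ℝ) ^ k))))) := by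
  set a₀ : ℝ := min δ δC / 2 with ha₀
  have ha₀p : 0 < a₀ := by rw [ha₀]; exact half_pos (lt_min hδ hδC)
  have hLk : 0 < (P.L : ℝ) ^ k := cast_pow_L_pos' k
  set D : ℝ := (supDist x b''.src : ℝ) / (P.L : ℝ) ^ k with hDdef
  set rk : ℝ := (supDist x x' : ℝ) / (P.L : ℝ) ^ k with hrk
  have hrk0 : 0 ≤ rk := div_nonneg (Nat.cast_nonneg _) hLk.le
  set K : ℝ := (P.d : ℝ) ^ 2 * (Real.exp (a₀ / 2) * ((2 * (1 + P.d / a₀)) ^ P.d) ^ 2) with hK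
  -- `|x′ − b″₋| ≥ |x − b″₋| − |x − x′|`
  have hD' : D - 1 ≤ (supDist x' b''.src : ℝ) / (P.L : ℝ) ^ k := by
    have ht : (supDist x b''.src : ℝ) ≤ (supDist x x' : ℝ) + (supDist x' b''.src : ℝ) := by
      exact_mod_cast supDist_triangle x x' b''.src
    have h1 : D ≤ rk + (supDist x' b''.src : ℝ) / (P.L : ℝ) ^ k := by
      rw [hDdef, hrk, ← add_div]
      exact div_le_div_of_nonneg_right ht hLk.le
    linarith
  refine (abs_holderTermDk_le hd hj hjk.le ha hδ hδC hMα hα hH hB hHol hC hne μ lam b'').trans ?_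
  set ℓ : ℝ := (P.L : ℝ) ^ (k - j) with hℓ
  have hℓ1 : 1 ≤ ℓ := one_le_pow₀ (by exact_mod_cast P.L_pos)
  have hℓ0 : 0 < ℓ := by linarith
  have hscale : ∀ z : TSite P 0, (supDist z b''.src : ℝ) / (P.L : ℝ) ^ j = ℓ * ((supDist z b''.src : ℝ) / (P.L : ℝ) ^ k) := by
    intro z
    rw [pow_eq_pow_mul_pow' hjk.le, ← hℓ]
    field_simp
  have erj : (supDist x x' : ℝ) / (P.L : ℝ) ^ j = ℓ * rk := by
    rw [hrk, pow_eq_pow_mul_pow' hjk.le, ← hℓ]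
    field_simp
  have hinv : ((P.L : ℝ) ^ j)⁻¹ = ((P.L : ℝ) ^ k)⁻¹ * ℓ := by
    rw [pow_eq_pow_mul_pow' hjk.le, ← hℓ, mul_inv, mul_assoc, inv_mul_cancel₀ hℓ0.ne', mul_one]
  -- `(ℓr)^α ≤ ℓ·r^α`
  have hrj : (ℓ * rk) ^ α ≤ ℓ * rk ^ α := by
    rw [Real.mul_rpow hℓ0.le hrk0]
    refine mul_le_mul_of_nonneg_right ?_ (Real.rpow_nonneg hrk0 α)
    have h := Real.rpow_le_rpow_of_exponent_le hℓ1 hα1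
    rwa [Real.rpow_one] at h
  -- both exponentials against `e^{−aℓ(D−1)}`
  set D' : ℝ := (supDist x' b''.src : ℝ) / (P.L : ℝ) ^ k with hD'def
  have haℓ : 0 < a₀ * ℓ := mul_pos ha₀p hℓ0
  have hE : Real.exp (-(a₀ * (ℓ * D))) + Real.exp (-(a₀ * (ℓ * D'))) ≤ 2 * Real.exp (-(a₀ * (ℓ * (D - 1)))) := by
    have h1 : Real.exp (-(a₀ * (ℓ * D))) ≤ Real.exp (-(a₀ * (ℓ * (D - 1)))) :=
      Real.exp_le_exp.2 (by nlinarith)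
    have h2 : Real.exp (-(a₀ * (ℓ * D'))) ≤ Real.exp (-(a₀ * (ℓ * (D - 1)))) :=
      Real.exp_le_exp.2 (by nlinarith)
    linarith
  have hB0 : 0 ≤ (M + Mα) * M * (MC * ℓ ^ (P.d - 2)) * K := by positivity
  have hp : ℓ * ℓ * ℓ ^ (P.d - 2) = ℓ ^ P.d := by
    rw [← pow_two, ← pow_add]; congr 1; omega
  have h2 : Real.exp (-(a₀ * (ℓ * (D - 1)))) ≤ Real.exp (-(a₀ * ℓ)) * (Real.exp (a₀ / 2) * Real.exp (-(a₀ / 2 * D))) := by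
    rw [← Real.exp_add, ← Real.exp_add]
    refine Real.exp_le_exp.2 ?_
    have hD1' : (1 : ℝ) ≤ D - 1 := by linarith
    nlinarith [mul_nonneg (sub_nonneg.2 hℓ1) (sub_nonneg.2 hD1'), ha₀p.le, mul_nonneg ha₀p.le (sub_nonneg.2 hD1'),
      mul_nonneg ha₀p.le (mul_nonneg (sub_nonneg.2 hℓ1) (sub_nonneg.2 hD1'))]
  have h4 : ℓ ^ P.d * Real.exp (-(a₀ * ℓ)) ≤ ((P.d + 1).factorial : ℝ) / (a₀ ^ (P.d + 1) * ℓ) :=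
    pow_mul_exp_neg_le ha₀p hℓ0 P.d
  rw [hscale x, hscale x', erj, hinv, ← hDdef, ← hD'def]
  calc ((P.L : ℝ) ^ k)⁻¹ * ℓ * (ℓ * rk) ^ α * ((M + Mα) * M * (MC * ℓ ^ (P.d - 2)) * K *
        (Real.exp (-(a₀ * (ℓ * D))) + Real.exp (-(a₀ * (ℓ * D')))))
      ≤ ((P.L : ℝ) ^ k)⁻¹ * ℓ * (ℓ * rk ^ α) * ((M + Mα) * M * (MC * ℓ ^ (P.d - 2)) * K *
        (2 * Real.exp (-(a₀ * (ℓ * (D - 1)))))) :=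
        mul_le_mul (mul_le_mul_of_nonneg_left hrj (by positivity)) (mul_le_mul_of_nonneg_left hE hB0) (by positivity)
          (by positivity)
    _ = ((P.L : ℝ) ^ k)⁻¹ * rk ^ α * (2 * ((M + Mα) * M * MC) * K) *
        (ℓ * ℓ * ℓ ^ (P.d - 2) * Real.exp (-(a₀ * (ℓ * (D - 1))))) := by ring
    _ ≤ ((P.L : ℝ) ^ k)⁻¹ * rk ^ α * (2 * ((M + Mα) * M * MC) * K) *
        (ℓ ^ P.d * (Real.exp (-(a₀ * ℓ)) * (Real.exp (a₀ / 2) * Real.exp (-(a₀ / 2 * D))))) := by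
        rw [hp]
        exact mul_le_mul_of_nonneg_left (mul_le_mul_of_nonneg_left h2 (by positivity)) (by positivity)
    _ = ((P.L : ℝ) ^ k)⁻¹ * rk ^ α * (2 * ((M + Mα) * M * MC) * K) *
        (ℓ ^ P.d * Real.exp (-(a₀ * ℓ)) * (Real.exp (a₀ / 2) * Real.exp (-(a₀ / 2 * D)))) := by ring
    _ ≤ _ := mul_le_mul_of_nonneg_left (mul_le_mul_of_nonneg_right h4 (by positivity)) (by positivity)

/-- **EXPONENTIAL DECAY OF THE HÖLDER QUOTIENT OF `∇𝒟_k(·, b″)` ON THE TORI, explicit constants, every `d ≥ 2`**: for fine sites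
`x ≠ x′` with `r := |x − x′|_∞/L^k ≤ 1`, `D := |x − b″₋|_∞/L^k ≥ 3`, `0 ≤ α ≤ 1` and `a = min(δ, δ_C)/2`:
`|Δ_λ𝒟_k(⟨x, μ⟩, b″) − Δ_λ𝒟_k(⟨x′, μ⟩, b″)| ≤ L^{−k}·r^α·2(M + M_α)MM_C·d²e^{a/2}K(a)²·(d+1)!/a^{d+1}·e^{a/2}·e^{−(a/2)D}` — i.e. the Hölder
quotient `|x − x′|^{−α}|∇𝒟_k(x, b″) − ∇𝒟_k(x′, b″)|` (`∇ = η⁻¹Δ`, distances in the unit `L^kη`) decays exponentially, UNIFORMLY IN `k` —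
GIVEN the sup, gradient and Hölder members of (7.2.2) for every `H_j`, `j < k`, and (7.2.3) for the unit-lattice `C^{(j)}`; the multiscale
sum `Σ_{j<k} L^{−(k−j)} ≤ 1` of `abs_holderTermDk_scaled_le`. [cite: BalabanImbrieJaffe1985, (4.4.4) p.312] -/
theorem abs_dkKernel_secondDiff_le (hd : 2 ≤ P.d) {k : ℕ} (hk : k ≤ P.m + P.K) {a : ℝ} (ha : 0 < a) {δ M Mα α δC MC : ℝ}
    (hδ : 0 < δ) (hδC : 0 < δC) (hM : 0 ≤ M) (hMα : 0 ≤ Mα) (hα : 0 ≤ α) (hα1 : α ≤ 1) (hMC : 0 ≤ MC)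
    (hH : ∀ (j : ℕ) (hj : j ≤ P.m + P.K), j < k → ∀ (μ ν : Fin P.d) (x : TSite P 0) (y : TSite P j),
      |(torusRep P j (deltaAData hj a)).H (x, μ) (y, ν)| ≤ M * Real.exp (-(δ * distEU P j x y)))
    (hB : ∀ (j : ℕ) (hj : j ≤ P.m + P.K), j < k → ∀ (μ ν : Fin P.d) (x : TSite P 0) (y : TSite P j),
      ‖fun lam : Fin P.d => (P.L : ℝ) ^ j *
          ((torusRep P j (deltaAData hj a)).H (x.shift lam, μ) (y, ν) - (torusRep P j (deltaAData hj a)).H (x, μ) (y, ν))‖ ≤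
        M * Real.exp (-(δ * distEU P j x y)))
    (hHol : ∀ (j : ℕ) (hj : j ≤ P.m + P.K), j < k → ∀ (μ ν : Fin P.d) (x x' : TSite P 0) (y : TSite P j), x ≠ x' →
      (supDist x x' : ℝ) / (P.L : ℝ) ^ j ≤ 1 →
      ((supDist x x' : ℝ) / (P.L : ℝ) ^ j) ^ (-α) *
          ‖fun lam : Fin P.d => (P.L : ℝ) ^ j * ((torusRep P j (deltaAData hj a)).H (x.shift lam, μ) (y, ν) -
              (torusRep P j (deltaAData hj a)).H (x, μ) (y, ν)) -
            (P.L : ℝ) ^ j * ((torusRep P j (deltaAData hj a)).H (x'.shift lam, μ) (y, ν) -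
              (torusRep P j (deltaAData hj a)).H (x', μ) (y, ν))‖ ≤
        Mα * Real.exp (-(δ * distEU P j x y)))
    (hC : ∀ j < k, ∀ b₁ b₂ : PBond P j, |⟪toEj P j (Pi.single b₁ 1),
      CE P ((P.eta j) ^ P.d) ((P.L : ℝ) ^ j) j (toEj P j (Pi.single b₂ 1))⟫| ≤ MC * Real.exp (-(δC * (supDist b₁.src b₂.src : ℝ))))
    {x x' : TSite P 0} (hne : x ≠ x') (hr : (supDist x x' : ℝ) / (P.L : ℝ) ^ k ≤ 1) (μ lam : Fin P.d) {b'' : PBond P 0}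
    (hD : 3 ≤ (supDist x b''.src : ℝ) / (P.L : ℝ) ^ k) :
    |(DkE P ((P.eta k) ^ P.d) ((P.L : ℝ) ^ k) k (toE P (Pi.single b'' 1)) ⟨x.shift lam, μ⟩ -
          DkE P ((P.eta k) ^ P.d) ((P.L : ℝ) ^ k) k (toE P (Pi.single b'' 1)) ⟨x, μ⟩) -
        (DkE P ((P.eta k) ^ P.d) ((P.L : ℝ) ^ k) k (toE P (Pi.single b'' 1)) ⟨x'.shift lam, μ⟩ -
          DkE P ((P.eta k) ^ P.d) ((P.L : ℝ) ^ k) k (toE P (Pi.single b'' 1)) ⟨x', μ⟩)| ≤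
      ((P.L : ℝ) ^ k)⁻¹ * ((supDist x x' : ℝ) / (P.L : ℝ) ^ k) ^ α *
        (2 * ((M + Mα) * M * MC) * ((P.d : ℝ) ^ 2 * (Real.exp (min δ δC / 2 / 2) * ((2 * (1 + P.d / (min δ δC / 2))) ^ P.d) ^ 2)) *
          (((P.d + 1).factorial : ℝ) / (min δ δC / 2) ^ (P.d + 1)) * Real.exp (min δ δC / 2 / 2)) *
        Real.exp (-(min δ δC / 2 / 2 * ((supDist x b''.src : ℝ) / (P.L : ℝ) ^ k))) := by
  have ha₀p : 0 < min δ δC / 2 := half_pos (lt_min hδ hδC)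
  rw [dkKernel_secondDiff_eq_sum]
  have hterm : ∀ j ∈ Finset.range k, |∑ b₁ : PBond P j, ∑ b₂ : PBond P j,
        ((HkE P ((P.eta k) ^ P.d) ((P.L : ℝ) ^ k) j (toEj P j (Pi.single b₁ 1)) ⟨x.shift lam, μ⟩ -
              HkE P ((P.eta k) ^ P.d) ((P.L : ℝ) ^ k) j (toEj P j (Pi.single b₁ 1)) ⟨x, μ⟩) -
            (HkE P ((P.eta k) ^ P.d) ((P.L : ℝ) ^ k) j (toEj P j (Pi.single b₁ 1)) ⟨x'.shift lam, μ⟩ -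
              HkE P ((P.eta k) ^ P.d) ((P.L : ℝ) ^ k) j (toEj P j (Pi.single b₁ 1)) ⟨x', μ⟩)) *
          ⟪toEj P j (Pi.single b₁ 1), CE P ((P.eta k) ^ P.d) ((P.L : ℝ) ^ k) j (toEj P j (Pi.single b₂ 1))⟫ *
          HkE P ((P.eta k) ^ P.d) ((P.L : ℝ) ^ k) j (toEj P j (Pi.single b₂ 1)) b''| ≤
      ((P.L : ℝ) ^ k)⁻¹ * ((supDist x x' : ℝ) / (P.L : ℝ) ^ k) ^ α *
        (2 * ((M + Mα) * M * MC) * ((P.d : ℝ) ^ 2 * (Real.exp (min δ δC / 2 / 2) * ((2 * (1 + P.d / (min δ δC / 2))) ^ P.d) ^ 2))) *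
        ((((P.d + 1).factorial : ℝ) / ((min δ δC / 2) ^ (P.d + 1) * (P.L : ℝ) ^ (k - j))) *
          (Real.exp (min δ δC / 2 / 2) * Real.exp (-(min δ δC / 2 / 2 * ((supDist x b''.src : ℝ) / (P.L : ℝ) ^ k))))) := by
    intro j hjm
    have hjk : j < k := Finset.mem_range.1 hjm
    have hj : j ≤ P.m + P.K := by omega
    exact abs_holderTermDk_scaled_le hd hjk hj ha hδ hδC hM hMα hα hα1 hMC (hH j hj hjk) (hB j hj hjk) (hHol j hj hjk)
      (hC j hjk) hne hr μ lam hD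
  calc _ ≤ ∑ j ∈ Finset.range k, ((P.L : ℝ) ^ k)⁻¹ * ((supDist x x' : ℝ) / (P.L : ℝ) ^ k) ^ α *
        (2 * ((M + Mα) * M * MC) * ((P.d : ℝ) ^ 2 * (Real.exp (min δ δC / 2 / 2) * ((2 * (1 + P.d / (min δ δC / 2))) ^ P.d) ^ 2))) *
        ((((P.d + 1).factorial : ℝ) / ((min δ δC / 2) ^ (P.d + 1) * (P.L : ℝ) ^ (k - j))) *
          (Real.exp (min δ δC / 2 / 2) * Real.exp (-(min δ δC / 2 / 2 * ((supDist x b''.src : ℝ) / (P.L : ℝ) ^ k))))) :=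
        (Finset.abs_sum_le_sum_abs _ _).trans (Finset.sum_le_sum hterm)
    _ = ((P.L : ℝ) ^ k)⁻¹ * ((supDist x x' : ℝ) / (P.L : ℝ) ^ k) ^ α *
        (2 * ((M + Mα) * M * MC) * ((P.d : ℝ) ^ 2 * (Real.exp (min δ δC / 2 / 2) * ((2 * (1 + P.d / (min δ δC / 2))) ^ P.d) ^ 2)) *
          (((P.d + 1).factorial : ℝ) / (min δ δC / 2) ^ (P.d + 1)) * Real.exp (min δ δC / 2 / 2)) *
        Real.exp (-(min δ δC / 2 / 2 * ((supDist x b''.src : ℝ) / (P.L : ℝ) ^ k))) *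
        ∑ j ∈ Finset.range k, ((P.L : ℝ) ^ (k - j))⁻¹ := by
        rw [Finset.mul_sum]
        refine Finset.sum_congr rfl fun j _ => ?_
        field_simp
    _ ≤ ((P.L : ℝ) ^ k)⁻¹ * ((supDist x x' : ℝ) / (P.L : ℝ) ^ k) ^ α *
        (2 * ((M + Mα) * M * MC) * ((P.d : ℝ) ^ 2 * (Real.exp (min δ δC / 2 / 2) * ((2 * (1 + P.d / (min δ δC / 2))) ^ P.d) ^ 2)) *
          (((P.d + 1).factorial : ℝ) / (min δ δC / 2) ^ (P.d + 1)) * Real.exp (min δ δC / 2 / 2)) *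
        Real.exp (-(min δ δC / 2 / 2 * ((supDist x b''.src : ℝ) / (P.L : ℝ) ^ k))) * 1 :=
        mul_le_mul_of_nonneg_left (sum_inv_pow_le_one k) (by positivity)
    _ = _ := by rw [mul_one]

end

end Literature.MathematicalPhysics.QuantumFieldTheory.BalabanImbrieJaffe1984to88.BIJ85CurlyDkHolderSum
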